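import Summits.QuantumFields.YangMills.Theorems.BalabanUVNodesN15CovariantTwoGridStaircaseCellFit
import Summits.QuantumFields.YangMills.Theorems.BalabanUVNodesN15CovariantTwoGridSpeciesFitC
import HarnessLib

/-!
# N15 = NE2, road (c) — PROGRAMME (PC) «[B9] Sect. C FOR THE LANDAU LETTER WITH PER-CUBE GAUGES», (PC-E) THE DIVERGENCE FIT o_B, PART 2 OF 3: THE LINE PRODUCTS AT TWO SPACINGS —
# DOUBLE TELESCOPING `‖Π_{t<N}T_{N+t} − Π_{t<N}T_t − N²·(T_N − T_{N−1})‖ ≤ 2N³(αβ + γ)` FOR UNITARY FACTORS WITH THREE LETTERS, THE ADJOINT-ACTION COMBINATION AT TWO SPACINGS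
# AND THE FOUR-POINT ADJOINT DIFFERENCE, BOUNDED POINTWISE IN THE FROBENIUS NORM, AND THE ENTRY LETTER OF A COORDINATE MATRIX FROM A POINTWISE BOUND (dag-n15-c g33, n15-c∕357)

Cell `pub-ymgap`, seat `pub-ymgap-dag-n15-c` (generation g33; R134 (a) seat, strategy s1 «first missing estimate»; HUMAN RULING D-0062; chair R424 venue).
`bears_on: R4∕N15 · K3⁸ SpineGivenEndpointR13SepCoPHV (stmt-QuantumFields-27366)`; filed `--kind proof --supports stmt-QuantumFields-27366 --as helper` — COUNT-NEUTRAL.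
Theorems only (generic finite-dimensional matrix analysis), 0 `def`, 0 `sorry`.  Imports BY NAME n15-c∕349 `…CovariantTwoGridStaircaseCellFit` (`norm_mprod_sub_mprod_le_of_unitary`;
through it n15-c∕341 `norm_chain_sub_le`, this seat's `mprod`∕`mprod_succ`∕`mprod_one`, `norm_unitary_mul_eq`∕`norm_mul_unitary_eq`, `conjTranspose_mprod_mul_self`) and n15-c∕344
`…CovariantTwoGridSpeciesFitC` (through it dag-n15-w2 `frobenius_norm_le_sqrt_card_mul_l2_opNorm`, `uN_frobenius_norm_of_unitary`, n15-a `abs_coordMat_entry_le`, `coordMat`∕`basisConst`).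
Nothing in the tree is modified, no landed name re-declared.

WHY (HOME HANDOFF §g32 «LOCATED ANALYSIS», the plan of n15-c∕356).  The displayed input `o_B` of the (PC-E-A) chain (n15-c∕344's `hB`, carried by 348∕353∕354∕355) compares, entrywise in
trace-form coordinates, the fine quantity `η′⁻²(Ad_{V′_μ(x′)} − Ad_{V′_μ(x′−e′_μ)})` with the coarse one `η⁻²(Ad_{V_μ(y)} − Ad_{V_μ(y−e_μ)})`, `y = πx′`, where under the covariant pairing
the coarse transformed bond variable is the ordered product `V_μ(y) = Π_{t<L^r}V′_μ(σy + te′_μ)` (n15-c∕341 `gauged_lineHol_eq_mprod`).  Along the fine line `T_t := V′_μ(σ(y−e_μ) + te′_μ)`,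
`t < 2N`, `N = L^r`: `V_μ(y−e_μ) = Π_{t<N}T_t`, `V_μ(y) = Π_{t<N}T_{N+t}`, and the fine quantity at the base point `σy` is `η′⁻²(Ad_{T_N} − Ad_{T_{N−1}})`.  THIS FILE is the matrix
analysis of that comparison AT THE BASE POINT (part 3, n15-c∕358, adds King's cell walk from `x′` to `σπx′` and the site bookkeeping):
* §1 ★ `mprod_sub_mprod_eq_sum` (`ΠF − ΠG = Σ_s (Π_{t<s}F_t)(F_s − G_s)(Π_{t>s}G_t)`), `norm_mprod_sub_one_le_sum_of_unitary`, `norm_sub_le_of_steps`, ★★★ `norm_lineProducts_defect_le`: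
  for unitary `T_t` (`t < 2N`) with `‖T_t − 1‖ ≤ α`, `‖T_{t+1} − T_t‖ ≤ β`, `‖T_{t+2} − 2T_{t+1} + T_t‖ ≤ γ`:  `‖Π_{t<N}T_{N+t} − Π_{t<N}T_t − N²·(T_N − T_{N−1})‖ ≤ 2N³(αβ + γ)` — the
  products telescope into `Σ_s L_s(T_{N+s} − T_s)R_s` with unitary `L_s, R_s` within `Nα` of `1`, each `T_{N+s} − T_s = Σ_{j<N}(T_{s+j+1} − T_{s+j})` is within `Nβ` of `0`, and each of the
  `N²` forward differences is within `2Nγ` of the one at the base point.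
* §2 (Frobenius scope) `frob_norm_mul_mul_conjTranspose_le` (`‖AXCᴴ‖_F ≤ |n|·‖A‖_{op}‖C‖_{op}·‖X‖_F`), ★ `abs_coordMat_entry_le_of_apply_le` (a pointwise bound `‖TX‖_F ≤ c‖X‖_F` gives
  `|coordMat e T _{ij}| ≤ κ_e·c`, `κ_e` the Frobenius-currency `basisConst`).
* §3 ★★★ `frob_twoGridAd_apply_le` — with `n_f = N·n_c`: for every `X`,
  `‖n_f²(T_NXT_Nᴴ − T_{N−1}XT_{N−1}ᴴ) − n_c²(Π₊XΠ₊ᴴ − Π₋XΠ₋ᴴ)‖_F ≤ |n|·(4n_c²N³(αβ + γ) + 2n_f²(N+1)αβ)·‖X‖_F` (the sandwich identity `sandwich_twoGrid_identity` through the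
  parallelogram of §1 and four sandwich bounds) — at `α = η′p`, `β = η′²q`, `γ = η′³c`, `N = L^r`, `n_f = η′⁻¹`, `n_c = η⁻¹` the right side is `|n|·(4η(pq + c) + 2(η + η′)pq)·‖X‖_F = O(η)`;
  ★★ `frob_adFourPoint_apply_le` — `‖aXaᴴ − bXbᴴ − cXcᴴ + dXdᴴ‖_F ≤ |n|·(2‖a − b − c + d‖ + ‖c − d‖‖a − c‖ + ‖b − d‖‖a − b‖)·‖X‖_F` for unitary `a, d` (the step of the fine
  quantity along King's cell walk: second order in the step letter plus the third letter).

HONEST FRAMING ∕ LIMITS.  Finite-dimensional linear algebra over DISPLAYED letters; the third letter `γ` is the MODEL second-order regularity letter of n15-c∕356 (beyond [B9] (3.35)–(3.36)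
as printed); nothing of [B9] asserted.  NE2⁺ NOT PRINTED ∕ NOT proved; N15 of record untouched; K3⁸ OPEN; counts of record UNMOVED (typed 28∕28 · discharged 8∕27); one finite 𝕋⁴ at
fixed ε per index — NOT infinite volume, NOT OS on ℝ⁴, NOT a mass gap, NOT Clay.  Restate-immune (no Theses import).
-/

set_option autoImplicit false

noncomputable section

open scoped BigOperators Matrix
open Finset

namespace Summit.QuantumFields.YangMills.BalabanUVNodes.N15.CovAvg

/-! ## §1 Ordered products of unitary factors with three letters: the double telescoping -/

section LineProducts

open scoped Matrix.Norms.L2Operator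

variable {mm : Type} [Fintype mm] [DecidableEq mm]

/-- ★ THE TELESCOPING IDENTITY FOR ORDERED PRODUCTS: `Π_{t<N}F_t − Π_{t<N}G_t = Σ_{s<N} (Π_{t<s}F_t)·(F_s − G_s)·(Π_{s<t<N}G_t)`. [folklore] -/
theorem mprod_sub_mprod_eq_sum (F G : ℕ → Matrix mm mm ℂ) (N : ℕ) :
    mprod F N - mprod G N = ∑ s ∈ range N, mprod F s * (F s - G s) * mprod (fun t => G (s + 1 + t)) (N - 1 - s) := by
  induction N with
  | zero => simp
  | succ N ih =>
      rw [Finset.sum_range_succ, show N + 1 - 1 - N = 0 by omega, mprod_zero, mul_one]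
      have hsum : ∑ s ∈ range N, mprod F s * (F s - G s) * mprod (fun t => G (s + 1 + t)) (N + 1 - 1 - s) =
          (∑ s ∈ range N, mprod F s * (F s - G s) * mprod (fun t => G (s + 1 + t)) (N - 1 - s)) * G N := by
        rw [Finset.sum_mul]
        refine Finset.sum_congr rfl fun s hs => ?_
        have hs' := Finset.mem_range.mp hs
        rw [show N + 1 - 1 - s = (N - 1 - s) + 1 by omega, mprod_succ, show s + 1 + (N - 1 - s) = N by omega]
        simp only [Matrix.mul_assoc]
      rw [hsum, ← ih, mprod_succ, mprod_succ]
      noncomm_ring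

/-- `‖Π_{i<N}F_i − 1‖ ≤ Σ_{i<N}‖F_i − 1‖` for unitary factors (operator norm). [folklore] -/
theorem norm_mprod_sub_one_le_sum_of_unitary {F : ℕ → Matrix mm mm ℂ} {N : ℕ} (hF : ∀ i < N, (F i)ᴴ * F i = 1) :
    ‖mprod F N - 1‖ ≤ ∑ i ∈ range N, ‖F i - 1‖ := by
  have h := norm_mprod_sub_mprod_le_of_unitary hF (G := fun _ => (1 : Matrix mm mm ℂ)) (fun i _ => by rw [Matrix.conjTranspose_one, Matrix.mul_one])
  rwa [mprod_one] at h

/-- along a sequence with steps `‖a_{t+1} − a_t‖ ≤ γ` for `t + 1 ≤ K`, any two terms with indices `≤ K` differ by at most `K·γ`. [folklore] -/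
theorem norm_sub_le_of_steps {E : Type} [SeminormedAddCommGroup E] (a : ℕ → E) {γ : ℝ} (hγ : 0 ≤ γ) {K : ℕ}
    (h : ∀ t, t + 1 ≤ K → ‖a (t + 1) - a t‖ ≤ γ) {m m' : ℕ} (hm : m ≤ K) (hm' : m' ≤ K) : ‖a m - a m'‖ ≤ K * γ := by
  wlog hle : m ≤ m' generalizing m m'
  · rw [norm_sub_rev]; exact this hm' hm (le_of_not_ge hle)
  obtain ⟨j, rfl⟩ := Nat.exists_eq_add_of_le hle
  have hc := norm_chain_sub_le (fun i => a (m + i)) (N := j) (κ := γ) (fun i hi => by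
    rw [norm_sub_rev, ← add_assoc]; exact h (m + i) (by omega))
  simp only [add_zero] at hc
  exact hc.trans (mul_le_mul_of_nonneg_right (by exact_mod_cast (by omega : j ≤ K)) hγ)

/-- ★★★ **THE LINE PRODUCTS AT TWO SPACINGS (DOUBLE TELESCOPING)**: for unitary `T_t`, `t < 2N` (`N ≥ 1`), with the three letters `‖T_t − 1‖ ≤ α`, `‖T_{t+1} − T_t‖ ≤ β`,
`‖(T_{t+2} − T_{t+1}) − (T_{t+1} − T_t)‖ ≤ γ` (operator norm):  `‖Π_{t<N}T_{N+t} − Π_{t<N}T_t − N²·(T_N − T_{N−1})‖ ≤ 2N³(αβ + γ)` — the coarse backward difference of the two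
straight holonomies is `N²` times the fine backward difference at the base point up to `O(N³(αβ + γ))` (`= O(η)·η′⁻²` at `α = η′p`, `β = η′²q`, `γ = η′³c`, `N = η∕η′`).
[cite: Balaban1985Averaging, (124)–(126) p.36 (the straight holonomy and its slow variation: shape); Balaban1985BackgroundPropagators, (3.35) p.396, (3.52) p.400 (shape)] -/
theorem norm_lineProducts_defect_le (T : ℕ → Matrix mm mm ℂ) {N : ℕ} (hN : 1 ≤ N) (hT : ∀ t, t < 2 * N → (T t)ᴴ * T t = 1) {α β γ : ℝ}
    (hα0 : 0 ≤ α) (hβ0 : 0 ≤ β) (hγ0 : 0 ≤ γ) (hα : ∀ t, t < 2 * N → ‖T t - 1‖ ≤ α) (hβ : ∀ t, t + 1 < 2 * N → ‖T (t + 1) - T t‖ ≤ β)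
    (hγ : ∀ t, t + 2 < 2 * N → ‖T (t + 2) - T (t + 1) - (T (t + 1) - T t)‖ ≤ γ) :
    ‖mprod (fun t => T (N + t)) N - mprod T N - ((N : ℝ) ^ 2) • (T N - T (N - 1))‖ ≤ 2 * (N : ℝ) ^ 3 * (α * β + γ) := by
  -- the products telescope
  have hP := mprod_sub_mprod_eq_sum (fun t => T (N + t)) T N
  -- the factor differences telescope: `T(N+s) − T s = Σ_{j<N} (T(s+j+1) − T(s+j))`
  have hX : ∀ s, T (N + s) - T s = ∑ j ∈ range N, (T (s + j + 1) - T (s + j)) := fun s => by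
    have h := Finset.sum_range_sub (fun j => T (s + j)) N
    simp only [add_zero] at h
    rw [add_comm N s, ← h]
    exact Finset.sum_congr rfl fun j _ => rfl
  -- `N²·D` as a double sum
  have hD : ((N : ℝ) ^ 2) • (T N - T (N - 1)) = ∑ _s ∈ range N, ∑ _j ∈ range N, (T N - T (N - 1)) := by
    rw [Finset.sum_const, Finset.sum_const, Finset.card_range, ← mul_nsmul', ← Nat.cast_smul_eq_nsmul ℝ, Nat.cast_mul, sq]
  -- splitting
  have hR1 : ∑ s ∈ range N, (mprod (fun t => T (N + t)) s * (T (N + s) - T s) * mprod (fun t => T (s + 1 + t)) (N - 1 - s) - (T (N + s) - T s)) =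
      (mprod (fun t => T (N + t)) N - mprod T N) - ∑ s ∈ range N, (T (N + s) - T s) := by
    rw [hP, Finset.sum_sub_distrib]
  have hR2 : ∑ s ∈ range N, ∑ j ∈ range N, ((T (s + j + 1) - T (s + j)) - (T N - T (N - 1))) =
      ∑ s ∈ range N, (T (N + s) - T s) - ((N : ℝ) ^ 2) • (T N - T (N - 1)) := by
    rw [hD, ← Finset.sum_sub_distrib]
    refine Finset.sum_congr rfl fun s _ => ?_
    rw [Finset.sum_sub_distrib, ← hX s]
  have hsplit : mprod (fun t => T (N + t)) N - mprod T N - ((N : ℝ) ^ 2) • (T N - T (N - 1)) =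
      ∑ s ∈ range N, (mprod (fun t => T (N + t)) s * (T (N + s) - T s) * mprod (fun t => T (s + 1 + t)) (N - 1 - s) - (T (N + s) - T s)) +
        ∑ s ∈ range N, ∑ j ∈ range N, ((T (s + j + 1) - T (s + j)) - (T N - T (N - 1))) := by
    rw [hR1, hR2]
    abel
  rw [hsplit]
  -- the unitary partial products
  have hL : ∀ s < N, ‖mprod (fun t => T (N + t)) s - 1‖ ≤ N * α := fun s hs => by
    refine (norm_mprod_sub_one_le_sum_of_unitary fun i hi => hT (N + i) (by omega)).trans ?_
    calc ∑ i ∈ range s, ‖T (N + i) - 1‖ ≤ ∑ _i ∈ range s, α := Finset.sum_le_sum fun i hi => hα (N + i) (by have := Finset.mem_range.mp hi; omega)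
      _ = s * α := by rw [Finset.sum_const, Finset.card_range, nsmul_eq_mul]
      _ ≤ N * α := mul_le_mul_of_nonneg_right (by exact_mod_cast hs.le) hα0
  have hR : ∀ s < N, ‖mprod (fun t => T (s + 1 + t)) (N - 1 - s) - 1‖ ≤ N * α := fun s hs => by
    refine (norm_mprod_sub_one_le_sum_of_unitary fun i hi => hT (s + 1 + i) (by omega)).trans ?_
    calc ∑ i ∈ range (N - 1 - s), ‖T (s + 1 + i) - 1‖ ≤ ∑ _i ∈ range (N - 1 - s), α :=
          Finset.sum_le_sum fun i hi => hα (s + 1 + i) (by have := Finset.mem_range.mp hi; omega)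
      _ = ((N - 1 - s : ℕ) : ℝ) * α := by rw [Finset.sum_const, Finset.card_range, nsmul_eq_mul]
      _ ≤ N * α := mul_le_mul_of_nonneg_right (by exact_mod_cast (by omega : N - 1 - s ≤ N)) hα0
  have hRu : ∀ s < N, (mprod (fun t => T (s + 1 + t)) (N - 1 - s))ᴴ * mprod (fun t => T (s + 1 + t)) (N - 1 - s) = 1 := fun s hs =>
    conjTranspose_mprod_mul_self fun i hi => hT (s + 1 + i) (by omega)
  have hXn : ∀ s < N, ‖T (N + s) - T s‖ ≤ N * β := fun s hs => by
    rw [hX s]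
    refine (norm_sum_le _ _).trans ?_
    calc ∑ j ∈ range N, ‖T (s + j + 1) - T (s + j)‖ ≤ ∑ _j ∈ range N, β := Finset.sum_le_sum fun j hj => hβ (s + j) (by have := Finset.mem_range.mp hj; omega)
      _ = N * β := by rw [Finset.sum_const, Finset.card_range, nsmul_eq_mul]
  -- first sum: `‖LXR − X‖ ≤ ‖L − 1‖‖X‖ + ‖X‖‖R − 1‖ ≤ 2N²αβ`
  have h1 : ∀ s ∈ range N, ‖mprod (fun t => T (N + t)) s * (T (N + s) - T s) * mprod (fun t => T (s + 1 + t)) (N - 1 - s) - (T (N + s) - T s)‖ ≤ 2 * ((N : ℝ) ^ 2 * (α * β)) := by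
    intro s hs
    have hs' := Finset.mem_range.mp hs
    set Lm := mprod (fun t => T (N + t)) s
    set Rm := mprod (fun t => T (s + 1 + t)) (N - 1 - s)
    set Xs := T (N + s) - T s
    have hid : Lm * Xs * Rm - Xs = (Lm - 1) * Xs * Rm + Xs * (Rm - 1) := by noncomm_ring
    rw [hid]
    calc ‖(Lm - 1) * Xs * Rm + Xs * (Rm - 1)‖ ≤ ‖(Lm - 1) * Xs * Rm‖ + ‖Xs * (Rm - 1)‖ := norm_add_le _ _
      _ ≤ ‖Lm - 1‖ * ‖Xs‖ + ‖Xs‖ * ‖Rm - 1‖ := by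
          rw [norm_mul_unitary_eq (hRu s hs')]
          exact add_le_add (norm_mul_le _ _) (norm_mul_le _ _)
      _ ≤ (N * α) * (N * β) + (N * β) * (N * α) :=
          add_le_add (mul_le_mul (hL s hs') (hXn s hs') (norm_nonneg _) (by positivity)) (mul_le_mul (hXn s hs') (hR s hs') (norm_nonneg _) (by positivity))
      _ = 2 * ((N : ℝ) ^ 2 * (α * β)) := by ring
  -- second sum: each forward difference is within `2Nγ` of the one at the base point
  have h2 : ∀ s ∈ range N, ∀ j ∈ range N, ‖(T (s + j + 1) - T (s + j)) - (T N - T (N - 1))‖ ≤ 2 * (N * γ) := by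
    intro s hs j hj
    have hs' := Finset.mem_range.mp hs
    have hj' := Finset.mem_range.mp hj
    have hstep : ∀ t, t + 1 ≤ 2 * N - 2 → ‖(T (t + 1 + 1) - T (t + 1)) - (T (t + 1) - T t)‖ ≤ γ := fun t ht => hγ t (by omega)
    have h := norm_sub_le_of_steps (fun t => T (t + 1) - T t) hγ0 (K := 2 * N - 2) hstep (m := s + j) (m' := N - 1) (by omega) (by omega)
    simp only [show N - 1 + 1 = N by omega] at h
    refine h.trans ?_
    have : ((2 * N - 2 : ℕ) : ℝ) ≤ 2 * N := by exact_mod_cast (by omega : 2 * N - 2 ≤ 2 * N)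
    nlinarith
  calc _ ≤ ‖∑ s ∈ range N, (mprod (fun t => T (N + t)) s * (T (N + s) - T s) * mprod (fun t => T (s + 1 + t)) (N - 1 - s) - (T (N + s) - T s))‖ +
          ‖∑ s ∈ range N, ∑ j ∈ range N, ((T (s + j + 1) - T (s + j)) - (T N - T (N - 1)))‖ := norm_add_le _ _
    _ ≤ ∑ s ∈ range N, 2 * ((N : ℝ) ^ 2 * (α * β)) + ∑ s ∈ range N, ∑ _j ∈ range N, 2 * (N * γ) := by
        refine add_le_add ((norm_sum_le _ _).trans (Finset.sum_le_sum h1)) ((norm_sum_le _ _).trans (Finset.sum_le_sum fun s hs => ?_))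
        exact (norm_sum_le _ _).trans (Finset.sum_le_sum fun j hj => h2 s hs j hj)
    _ = 2 * (N : ℝ) ^ 3 * (α * β + γ) := by simp only [Finset.sum_const, Finset.card_range, nsmul_eq_mul]; ring

end LineProducts

/-! ## §2 Frobenius scope: sandwich bounds and the entry letter of a coordinate matrix from a pointwise bound -/

section Frobenius

open scoped Matrix.Norms.Frobenius
open Summit.QuantumFields.YangMills.BalabanUVNodes.N15.MatrixSpecies (coordMat basisConst basisConst_nonneg)
open Summit.QuantumFields.YangMills.BalabanUVNodes.N15.CurvedSpecies (frobenius_norm_le_sqrt_card_mul_l2_opNorm abs_coordMat_entry_le)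

variable {mm : Type} [Fintype mm] [DecidableEq mm]

/-- SANDWICH BOUND: `‖A·X·Cᴴ‖_F ≤ |n|·(‖A‖_{op}‖C‖_{op})·‖X‖_F` (Frobenius submultiplicativity, `‖Cᴴ‖_F = ‖C‖_F`, `‖·‖_F ≤ √|n|·‖·‖_{op}`; the right-hand norms of `A`, `C` are Mathlib's
L²-operator norms, written explicitly since this section's instances are the Frobenius ones). [folklore] -/
theorem frob_norm_mul_mul_conjTranspose_le (A X C : Matrix mm mm ℂ) :
    ‖A * X * Cᴴ‖ ≤ Fintype.card mm * (@Norm.norm _ Matrix.instL2OpNormedAddCommGroup.toNorm A * @Norm.norm _ Matrix.instL2OpNormedAddCommGroup.toNorm C) * ‖X‖ := by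
  have hA := frobenius_norm_le_sqrt_card_mul_l2_opNorm A
  have hC := frobenius_norm_le_sqrt_card_mul_l2_opNorm C
  have hA0 : 0 ≤ @Norm.norm _ Matrix.instL2OpNormedAddCommGroup.toNorm A := @norm_nonneg _ Matrix.instL2OpNormedAddCommGroup.toSeminormedAddCommGroup.toSeminormedAddGroup A
  have hC0 : 0 ≤ @Norm.norm _ Matrix.instL2OpNormedAddCommGroup.toNorm C := @norm_nonneg _ Matrix.instL2OpNormedAddCommGroup.toSeminormedAddCommGroup.toSeminormedAddGroup C
  calc ‖A * X * Cᴴ‖ ≤ ‖A‖ * ‖X‖ * ‖Cᴴ‖ := (norm_mul_le _ _).trans (mul_le_mul_of_nonneg_right (norm_mul_le _ _) (norm_nonneg _))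
    _ = ‖A‖ * ‖C‖ * ‖X‖ := by rw [Matrix.frobenius_norm_conjTranspose]; ring
    _ ≤ (Real.sqrt (Fintype.card mm) * @Norm.norm _ Matrix.instL2OpNormedAddCommGroup.toNorm A) * (Real.sqrt (Fintype.card mm) * @Norm.norm _ Matrix.instL2OpNormedAddCommGroup.toNorm C) * ‖X‖ :=
        mul_le_mul_of_nonneg_right (mul_le_mul hA hC (norm_nonneg _) (by positivity)) (norm_nonneg _)
    _ = _ := by rw [show Real.sqrt (Fintype.card mm) * @Norm.norm _ Matrix.instL2OpNormedAddCommGroup.toNorm A * (Real.sqrt (Fintype.card mm) * @Norm.norm _ Matrix.instL2OpNormedAddCommGroup.toNorm C) =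
        (Real.sqrt (Fintype.card mm) * Real.sqrt (Fintype.card mm)) * (@Norm.norm _ Matrix.instL2OpNormedAddCommGroup.toNorm A * @Norm.norm _ Matrix.instL2OpNormedAddCommGroup.toNorm C) by ring,
        Real.mul_self_sqrt (Nat.cast_nonneg _)]

/-- a four-term combination with two nonnegative scalars (Frobenius norm). [folklore] -/
theorem frob_norm_comb4_le {p q : ℝ} (hp : 0 ≤ p) (hq : 0 ≤ q) (P Q R S : Matrix mm mm ℂ) :
    ‖p • P + p • Q - q • R - q • S‖ ≤ p * ‖P‖ + p * ‖Q‖ + q * ‖R‖ + q * ‖S‖ := by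
  calc ‖p • P + p • Q - q • R - q • S‖ ≤ ‖p • P‖ + ‖p • Q‖ + ‖q • R‖ + ‖q • S‖ :=
        (norm_sub_le _ _).trans (add_le_add ((norm_sub_le _ _).trans (add_le_add (norm_add_le _ _) le_rfl)) le_rfl)
    _ = _ := by rw [norm_smul, norm_smul, norm_smul, norm_smul, Real.norm_of_nonneg hp, Real.norm_of_nonneg hq]

/-- a four-term sum (Frobenius norm). [folklore] -/
theorem frob_norm_add4_le (P Q R S : Matrix mm mm ℂ) : ‖P + Q + R + S‖ ≤ ‖P‖ + ‖Q‖ + ‖R‖ + ‖S‖ :=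
  (norm_add_le _ _).trans (add_le_add ((norm_add_le _ _).trans (add_le_add (norm_add_le _ _) le_rfl)) le_rfl)

variable {ι : Type} [Fintype ι] [DecidableEq ι] (e : Matrix mm mm ℂ ≃L[ℝ] (ι → ℝ))

/-- ★ ENTRY LETTER FROM A POINTWISE BOUND: `‖T X‖_F ≤ c·‖X‖_F` for all `X` (`c ≥ 0`) ⟹ `|coordMat e T _{ij}| ≤ κ_e·c` (n15-a `abs_coordMat_entry_le` + `opNorm_le_bound`). [folklore] -/
theorem abs_coordMat_entry_le_of_apply_le (T : Matrix mm mm ℂ →L[ℝ] Matrix mm mm ℂ) {c : ℝ} (hc : 0 ≤ c) (h : ∀ X, ‖T X‖ ≤ c * ‖X‖) (i j : ι) :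
    |coordMat e T i j| ≤ basisConst e * c :=
  (abs_coordMat_entry_le e T i j).trans (mul_le_mul_of_nonneg_left (ContinuousLinearMap.opNorm_le_bound T hc h) (basisConst_nonneg e))

end Frobenius

/-! ## §3 The adjoint actions at two spacings and the four-point adjoint difference, pointwise in the Frobenius norm -/

section Adjoint

open scoped Matrix.Norms.L2Operator

variable {mm : Type} [Fintype mm] [DecidableEq mm]

omit [DecidableEq mm] in
/-- THE SANDWICH IDENTITY AT TWO SPACINGS: with `E := c − d − N₂·(a − b)` and `n_f² = n_c²N₂`,
`n_f²(aXaᴴ − bXbᴴ) − n_c²(cXcᴴ − dXdᴴ) = n_f²(a−b)X(a−c)ᴴ + n_f²(b−d)X(a−b)ᴴ − n_c²·EXcᴴ − n_c²·dXEᴴ`. [folklore] -/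
theorem sandwich_twoGrid_identity (a b c d X : Matrix mm mm ℂ) (N2 nc2 : ℝ) :
    (nc2 * N2) • (a * X * aᴴ - b * X * bᴴ) - nc2 • (c * X * cᴴ - d * X * dᴴ) =
      (nc2 * N2) • ((a - b) * X * (a - c)ᴴ) + (nc2 * N2) • ((b - d) * X * (a - b)ᴴ) - nc2 • ((c - d - N2 • (a - b)) * X * cᴴ) - nc2 • (d * X * (c - d - N2 • (a - b))ᴴ) := by
  simp only [Matrix.conjTranspose_sub, Matrix.conjTranspose_smul, star_trivial, Matrix.sub_mul, Matrix.mul_sub, Matrix.smul_mul, Matrix.mul_smul, smul_sub, smul_smul]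
  module

omit [DecidableEq mm] in
/-- THE FOUR-POINT IDENTITY: `aXaᴴ − bXbᴴ − cXcᴴ + dXdᴴ = (a−b−c+d)Xaᴴ + (c−d)X(a−c)ᴴ + (b−d)X(a−b)ᴴ + dX(a−b−c+d)ᴴ`. [folklore] -/
theorem sandwich_fourPoint_identity (a b c d X : Matrix mm mm ℂ) :
    a * X * aᴴ - b * X * bᴴ - c * X * cᴴ + d * X * dᴴ =
      (a - b - c + d) * X * aᴴ + (c - d) * X * (a - c)ᴴ + (b - d) * X * (a - b)ᴴ + d * X * (a - b - c + d)ᴴ := by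
  simp only [Matrix.conjTranspose_sub, Matrix.conjTranspose_add, Matrix.sub_mul, Matrix.add_mul, Matrix.mul_sub, Matrix.mul_add]
  abel

variable [Nonempty mm]

/-- a unitary matrix has operator norm `1`. [folklore] -/
theorem norm_eq_one_of_conjTranspose_mul_self {u : Matrix mm mm ℂ} (hu : uᴴ * u = 1) : ‖u‖ = 1 :=
  CStarRing.norm_of_mem_unitary (Matrix.mem_unitaryGroup_iff'.mpr (by rwa [Matrix.star_eq_conjTranspose]))

/-- ★★★ **THE ADJOINT ACTIONS OF THE LINE PRODUCTS AT TWO SPACINGS, POINTWISE IN THE FROBENIUS NORM**: unitary `T_t` (`t < 2N`, `N ≥ 1`) with the three letters `α, β, γ` of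
`norm_lineProducts_defect_le`, `Π₋ = Π_{t<N}T_t`, `Π₊ = Π_{t<N}T_{N+t}`, any real `n_c`, `n_f = N·n_c`: for every matrix `X`,
`‖n_f²(T_NXT_Nᴴ − T_{N−1}XT_{N−1}ᴴ) − n_c²(Π₊XΠ₊ᴴ − Π₋XΠ₋ᴴ)‖_F ≤ |n|·(4n_c²N³(αβ + γ) + 2n_f²(N+1)αβ)·‖X‖_F` — the fine backward difference of the adjoint actions at the base
point against the coarse one (left side in the Frobenius norm, written explicitly; letters in the operator norm).
[cite: Balaban1985Averaging, (124)–(126) p.36 (shape); Balaban1985BackgroundPropagators, (3.35) p.396, (3.50)–(3.52) p.400 (shape: `R(U) = Ad`)] -/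
theorem frob_twoGridAd_apply_le (T : ℕ → Matrix mm mm ℂ) {N : ℕ} (hN : 1 ≤ N) (hT : ∀ t, t < 2 * N → (T t)ᴴ * T t = 1) {α β γ : ℝ}
    (hα0 : 0 ≤ α) (hβ0 : 0 ≤ β) (hγ0 : 0 ≤ γ) (hα : ∀ t, t < 2 * N → ‖T t - 1‖ ≤ α) (hβ : ∀ t, t + 1 < 2 * N → ‖T (t + 1) - T t‖ ≤ β)
    (hγ : ∀ t, t + 2 < 2 * N → ‖T (t + 2) - T (t + 1) - (T (t + 1) - T t)‖ ≤ γ) (nc : ℝ) (X : Matrix mm mm ℂ) :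
    @Norm.norm _ Matrix.frobeniusSeminormedAddCommGroup.toNorm
        (((N * nc) ^ 2) • (T N * X * (T N)ᴴ - T (N - 1) * X * (T (N - 1))ᴴ) -
          (nc ^ 2) • (mprod (fun t => T (N + t)) N * X * (mprod (fun t => T (N + t)) N)ᴴ - mprod T N * X * (mprod T N)ᴴ)) ≤
      Fintype.card mm * (4 * nc ^ 2 * (N : ℝ) ^ 3 * (α * β + γ) + 2 * (N * nc) ^ 2 * ((N + 1) * α * β)) * @Norm.norm _ Matrix.frobeniusSeminormedAddCommGroup.toNorm X := by
  set a := T N with ha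
  set b := T (N - 1) with hb
  set c := mprod (fun t => T (N + t)) N with hc
  set dd := mprod T N with hdd
  have hE := norm_lineProducts_defect_le T hN hT hα0 hβ0 hγ0 hα hβ hγ
  rw [← hc, ← hdd, ← ha, ← hb] at hE
  have h2N : N < 2 * N := by omega
  -- letters of the four matrices
  have hab : ‖a - b‖ ≤ β := by
    have h := hβ (N - 1) (by omega); rwa [show N - 1 + 1 = N by omega] at h
  have hcu : cᴴ * c = 1 := conjTranspose_mprod_mul_self fun t ht => hT (N + t) (by omega)
  have hdu : ddᴴ * dd = 1 := conjTranspose_mprod_mul_self fun t ht => hT t (by omega)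
  have hc1 : ‖c - 1‖ ≤ N * α := by
    refine (norm_mprod_sub_one_le_sum_of_unitary fun i hi => hT (N + i) (by omega)).trans ?_
    calc ∑ i ∈ range N, ‖T (N + i) - 1‖ ≤ ∑ _i ∈ range N, α := Finset.sum_le_sum fun i hi => hα (N + i) (by have := Finset.mem_range.mp hi; omega)
      _ = N * α := by rw [Finset.sum_const, Finset.card_range, nsmul_eq_mul]
  have hd1 : ‖dd - 1‖ ≤ N * α := by
    refine (norm_mprod_sub_one_le_sum_of_unitary fun i hi => hT i (by omega)).trans ?_
    calc ∑ i ∈ range N, ‖T i - 1‖ ≤ ∑ _i ∈ range N, α := Finset.sum_le_sum fun i hi => hα i (by have := Finset.mem_range.mp hi; omega)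
      _ = N * α := by rw [Finset.sum_const, Finset.card_range, nsmul_eq_mul]
  have hac : ‖a - c‖ ≤ (N + 1) * α := by
    have e1 : a - c = (a - 1) - (c - 1) := by abel
    rw [e1]
    calc ‖(a - 1) - (c - 1)‖ ≤ ‖a - 1‖ + ‖c - 1‖ := norm_sub_le _ _
      _ ≤ α + N * α := add_le_add (hα N h2N) hc1
      _ = (N + 1) * α := by ring
  have hbd : ‖b - dd‖ ≤ (N + 1) * α := by
    have e1 : b - dd = (b - 1) - (dd - 1) := by abel
    rw [e1]
    calc ‖(b - 1) - (dd - 1)‖ ≤ ‖b - 1‖ + ‖dd - 1‖ := norm_sub_le _ _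
      _ ≤ α + N * α := add_le_add (hα (N - 1) (by omega)) hd1
      _ = (N + 1) * α := by ring
  have hcn : ‖c‖ = 1 := norm_eq_one_of_conjTranspose_mul_self hcu
  have hdn : ‖dd‖ = 1 := norm_eq_one_of_conjTranspose_mul_self hdu
  -- the identity and the four sandwich bounds
  have hid := sandwich_twoGrid_identity a b c dd X ((N : ℝ) ^ 2) (nc ^ 2)
  have hnf : nc ^ 2 * (N : ℝ) ^ 2 = (N * nc) ^ 2 := by ring
  rw [hnf] at hid
  set E := c - dd - ((N : ℝ) ^ 2) • (a - b) with hEdef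
  have hm0 : (0 : ℝ) ≤ Fintype.card mm := Nat.cast_nonneg _
  set XF := @Norm.norm _ Matrix.frobeniusSeminormedAddCommGroup.toNorm X with hXF
  have hXF0 : 0 ≤ XF := @norm_nonneg _ Matrix.frobeniusSeminormedAddCommGroup.toSeminormedAddGroup X
  have s1 := frob_norm_mul_mul_conjTranspose_le (a - b) X (a - c)
  have s2 := frob_norm_mul_mul_conjTranspose_le (b - dd) X (a - b)
  have s3 := frob_norm_mul_mul_conjTranspose_le E X c
  have s4 := frob_norm_mul_mul_conjTranspose_le dd X E
  have t1 : @Norm.norm _ Matrix.frobeniusSeminormedAddCommGroup.toNorm ((a - b) * X * (a - c)ᴴ) ≤ Fintype.card mm * (β * ((N + 1) * α)) * XF :=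
    s1.trans (mul_le_mul_of_nonneg_right (mul_le_mul_of_nonneg_left (mul_le_mul hab hac (norm_nonneg _) hβ0) hm0) hXF0)
  have t2 : @Norm.norm _ Matrix.frobeniusSeminormedAddCommGroup.toNorm ((b - dd) * X * (a - b)ᴴ) ≤ Fintype.card mm * (((N + 1) * α) * β) * XF :=
    s2.trans (mul_le_mul_of_nonneg_right (mul_le_mul_of_nonneg_left (mul_le_mul hbd hab (norm_nonneg _) (by positivity)) hm0) hXF0)
  have t3 : @Norm.norm _ Matrix.frobeniusSeminormedAddCommGroup.toNorm (E * X * cᴴ) ≤ Fintype.card mm * (2 * (N : ℝ) ^ 3 * (α * β + γ) * 1) * XF :=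
    s3.trans (mul_le_mul_of_nonneg_right (mul_le_mul_of_nonneg_left (mul_le_mul hE hcn.le (norm_nonneg _) (by positivity)) hm0) hXF0)
  have t4 : @Norm.norm _ Matrix.frobeniusSeminormedAddCommGroup.toNorm (dd * X * Eᴴ) ≤ Fintype.card mm * (1 * (2 * (N : ℝ) ^ 3 * (α * β + γ))) * XF :=
    s4.trans (mul_le_mul_of_nonneg_right (mul_le_mul_of_nonneg_left (mul_le_mul hdn.le hE (norm_nonneg _) zero_le_one) hm0) hXF0)
  rw [hid]
  have hnc2 : 0 ≤ nc ^ 2 := sq_nonneg _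
  have hnf2 : 0 ≤ ((N : ℝ) * nc) ^ 2 := sq_nonneg _
  calc _ ≤ ((N : ℝ) * nc) ^ 2 * @Norm.norm _ Matrix.frobeniusSeminormedAddCommGroup.toNorm ((a - b) * X * (a - c)ᴴ) +
        ((N : ℝ) * nc) ^ 2 * @Norm.norm _ Matrix.frobeniusSeminormedAddCommGroup.toNorm ((b - dd) * X * (a - b)ᴴ) +
        nc ^ 2 * @Norm.norm _ Matrix.frobeniusSeminormedAddCommGroup.toNorm (E * X * cᴴ) + nc ^ 2 * @Norm.norm _ Matrix.frobeniusSeminormedAddCommGroup.toNorm (dd * X * Eᴴ) :=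
        frob_norm_comb4_le hnf2 hnc2 _ _ _ _
    _ ≤ ((N : ℝ) * nc) ^ 2 * (Fintype.card mm * (β * ((N + 1) * α)) * XF) + ((N : ℝ) * nc) ^ 2 * (Fintype.card mm * (((N + 1) * α) * β) * XF) +
        nc ^ 2 * (Fintype.card mm * (2 * (N : ℝ) ^ 3 * (α * β + γ) * 1) * XF) + nc ^ 2 * (Fintype.card mm * (1 * (2 * (N : ℝ) ^ 3 * (α * β + γ))) * XF) := by
        gcongr
    _ = Fintype.card mm * (4 * nc ^ 2 * (N : ℝ) ^ 3 * (α * β + γ) + 2 * (N * nc) ^ 2 * ((N + 1) * α * β)) * XF := by ring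

/-- ★★ **THE FOUR-POINT ADJOINT DIFFERENCE, POINTWISE IN THE FROBENIUS NORM**: for unitary `a, d` and arbitrary `b, c`, every `X`:
`‖aXaᴴ − bXbᴴ − cXcᴴ + dXdᴴ‖_F ≤ |n|·(2‖a − b − c + d‖ + ‖c − d‖‖a − c‖ + ‖b − d‖‖a − b‖)·‖X‖_F` (operator norms on the right) — the step of the fine quantity along a King cell:
second order in the step letter plus the third letter. [cite: Balaban1985BackgroundPropagators, (3.35) p.396, (3.50) p.400 (shape)] -/
theorem frob_adFourPoint_apply_le {a b c d : Matrix mm mm ℂ} (ha : aᴴ * a = 1) (hd : dᴴ * d = 1) (X : Matrix mm mm ℂ) :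
    @Norm.norm _ Matrix.frobeniusSeminormedAddCommGroup.toNorm (a * X * aᴴ - b * X * bᴴ - c * X * cᴴ + d * X * dᴴ) ≤
      Fintype.card mm * (2 * ‖a - b - c + d‖ + ‖c - d‖ * ‖a - c‖ + ‖b - d‖ * ‖a - b‖) * @Norm.norm _ Matrix.frobeniusSeminormedAddCommGroup.toNorm X := by
  have han : ‖a‖ = 1 := norm_eq_one_of_conjTranspose_mul_self ha
  have hdn : ‖d‖ = 1 := norm_eq_one_of_conjTranspose_mul_self hd
  have hm0 : (0 : ℝ) ≤ Fintype.card mm := Nat.cast_nonneg _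
  set XF := @Norm.norm _ Matrix.frobeniusSeminormedAddCommGroup.toNorm X with hXF
  have hXF0 : 0 ≤ XF := @norm_nonneg _ Matrix.frobeniusSeminormedAddCommGroup.toSeminormedAddGroup X
  rw [sandwich_fourPoint_identity]
  have s1 := frob_norm_mul_mul_conjTranspose_le (a - b - c + d) X a
  have s2 := frob_norm_mul_mul_conjTranspose_le (c - d) X (a - c)
  have s3 := frob_norm_mul_mul_conjTranspose_le (b - d) X (a - b)
  have s4 := frob_norm_mul_mul_conjTranspose_le d X (a - b - c + d)
  rw [han] at s1
  rw [hdn] at s4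
  calc _ ≤ _ := frob_norm_add4_le _ _ _ _
    _ ≤ Fintype.card mm * (‖a - b - c + d‖ * 1) * XF + Fintype.card mm * (‖c - d‖ * ‖a - c‖) * XF + Fintype.card mm * (‖b - d‖ * ‖a - b‖) * XF +
        Fintype.card mm * (1 * ‖a - b - c + d‖) * XF := add_le_add (add_le_add (add_le_add s1 s2) s3) s4
    _ = Fintype.card mm * (2 * ‖a - b - c + d‖ + ‖c - d‖ * ‖a - c‖ + ‖b - d‖ * ‖a - b‖) * XF := by ring

end Adjoint

end Summit.QuantumFields.YangMills.BalabanUVNodes.N15.CovAvg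

end
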